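import Literature.Analysis.FluidPDE.OseenDuhamelNearSmooth
import Literature.Analysis.FluidPDE.OseenDuhamelCutoff
import HarnessLib

/-!
# The weighted bilinear estimate at unit parabolic scale

Analysis/FluidPDE proof file (everything proved, no definitions) on the discharge path of the
named fact `Literature.Analysis.FluidPDE.WeightedBilinearEstimate`
(`NSBoundedMildWeightedPicard.lean`; Koch–Nadirashvili–Seregin–Šverák, Acta Math. 203 (2009) =
arXiv:0709.3599, §4 p. 8, (4.3)–(4.5) and Prop. 4.1: "The key is an estimate of `B` with the
same form as (4.4) but in spaces with norms given by the expression on the left-hand side of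
(4.5)"). At unit viscosity and unit parabolic scale the Duhamel term
`B^1_0(V, W)(θ, ξ) = ∫₀^θ ∫ K(θ - τ, ξ - y)[V(τ, y), W(τ, y)] dy dτ` (`oseenDuhamel 1 0 V W`) of
fields `V`, `W` jointly `C^∞` on the slab `(0, T') × E`, `T' > 1`, bounded there and with bounded
derivatives at heights `≥ 1/4`, is split with the smooth time cutoff `χ = duhamelCutoff`
(`χ = 0` below `1/4`, `χ = 1` above `1/2`; `OseenDuhamelCutoff.lean`) by bilinearity,
`K[V, W] = K[(1 - χ²)V, W] + K[χV, χW]`, into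

* the **far part** `∫_{(0,1/2)×E} K(θ - τ, ξ - y)[(1 - χ(τ)²)V(τ,y), W(τ,y)]` of bounded
  measurable fields, jointly `C^∞` for `θ > 1/2` with `‖D^m‖ ≤ C_m M_V M_W (θ - 1/2)^{-1/2-m}/2`
  (`OseenDuhamelFar.lean`: the derivatives fall on the kernel), and
* the **near part** `∫_{(0,b)×E} K(s, z)[(χV)(p - q), (χW)(p - q)] dq`, `p = (θ, ξ)`,
  `q = (s, z)`, `b = min T' 2` (the reflection `q ↦ p - q` of `(0, θ) × E` and the vanishing of
  `χV` below the height `1/4`), jointly `C^∞` for `θ < b` with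
  `‖D^m‖ ≤ 2^m C_F C_G · C · 2√b` (`OseenDuhamelNearSmooth.lean`: the derivatives fall on the
  cut-off fields `χV`, `χW`, whose derivatives of orders `≤ N` below the height `1` are bounded
  by `c_N` times the bounds of `V`, `W` at heights in `[1/4, 1]`).

Results (`oseenDuhamel_one_eq_far_add_near`, `contDiffOn_oseenDuhamel_one`,
`exists_norm_iteratedFDeriv_oseenDuhamel_one_le`): `B^1_0(V, W)` is jointly `C^∞` on
`(1/2, b) × E`, and for every `N` there is `A_N = A_N(E)` with
`‖D^m B^1_0(V, W)(1, ξ)‖ ≤ A_N C_V C_W` for `m ≤ N`, where `C_V ≥ sup |V|` bounds the derivatives of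
orders `≤ N` of `V` at heights in `[1/4, 1]` (and `C_W` likewise). Transported to every scale by
the parabolic rescaling (`OseenDuhamelRescale.lean`), this is the weighted estimate (B) of
`NSBoundedMildWeightedPicard.lean`.

## References

* G. Koch, N. Nadirashvili, G. Seregin, V. Šverák, *Liouville theorems for the Navier–Stokes
  equations and applications*, Acta Math. 203 (2009) = arXiv:0709.3599, §4 p. 8: (4.3)–(4.5),
  Prop. 4.1, Remark 4.2. [KochNadirashviliSereginSverak2009]
* Y. Giga, K. Inui, S. Matsui, *On the Cauchy problem for the Navier–Stokes equations with
  nondecaying initial data*, Quad. Mat. 4 (1999) (the weighted norms `sup t^{k/2}‖∇ᵏu(t)‖_∞`).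
-/

noncomputable section

open MeasureTheory Set Function Filter Metric Real
open _root_.Topology
open scoped RealInnerProductSpace ContDiff ENNReal

namespace Literature.Analysis.FluidPDE

/-! ### The cut-off fields `χV` -/

section CutoffField

variable {E : Type*} [NormedAddCommGroup E] [NormedSpace ℝ E] {T' : ℝ} {V : ℝ → E → E}

/-- **All derivatives of orders `≤ N` of the lifted cutoff are bounded by one constant.**
[folklore] -/
theorem exists_forall_le_norm_iteratedFDeriv_duhamelCutoff_fst_le (N : ℕ) :
    ∃ c : ℝ, 0 ≤ c ∧ ∀ k ≤ N, ∀ r : ℝ × E,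
      ‖iteratedFDeriv ℝ k (fun r : ℝ × E => duhamelCutoff r.1) r‖ ≤ c := by
  have h : ∀ k : ℕ, ∃ c : ℝ, ∀ r : ℝ × E, True →
      ‖iteratedFDeriv ℝ k (fun r : ℝ × E => duhamelCutoff r.1) r‖ ≤ c := by
    intro k
    obtain ⟨c, -, hc⟩ := exists_norm_iteratedFDeriv_duhamelCutoff_fst_le (E := E) k
    exact ⟨c, fun r _ => hc r⟩
  obtain ⟨c, hc0, hc⟩ := exists_forall_le_norm_iteratedFDeriv_le h N
  exact ⟨c, hc0, fun k hk r => hc k hk r trivial⟩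

/-- The cut-off field `χ(τ)V(τ, y)` vanishes below the height `1/4`. [folklore] -/
theorem duhamelCutoff_smul_eq_zero {r : ℝ × E} (hr : r.1 ≤ 1 / 4) (V : ℝ → E → E) :
    duhamelCutoff r.1 • V r.1 r.2 = 0 := by
  rw [duhamelCutoff_of_le hr, zero_smul]

/-- The cut-off field vanishes near every point below the height `1/4`. [folklore] -/
theorem duhamelCutoff_smul_eventuallyEq_zero {r : ℝ × E} (hr : r.1 < 1 / 4) (V : ℝ → E → E) :
    (fun r : ℝ × E => duhamelCutoff r.1 • V r.1 r.2) =ᶠ[𝓝 r] fun _ => 0 := by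
  have hopen : IsOpen (Iio (1 / 4 : ℝ) ×ˢ (univ : Set E)) := isOpen_Iio.prod isOpen_univ
  filter_upwards [hopen.mem_nhds (mk_mem_prod hr (mem_univ r.2))] with r' hr'
  exact duhamelCutoff_smul_eq_zero (le_of_lt (mem_prod.1 hr').1) V

/-- **All derivatives of the cut-off field vanish below the height `1/4`.** [folklore] -/
theorem iteratedFDeriv_duhamelCutoff_smul_eq_zero {r : ℝ × E} (hr : r.1 < 1 / 4) (V : ℝ → E → E)
    (i : ℕ) : iteratedFDeriv ℝ i (fun r : ℝ × E => duhamelCutoff r.1 • V r.1 r.2) r = 0 := by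
  rw [((duhamelCutoff_smul_eventuallyEq_zero hr V).iteratedFDeriv ℝ i).eq_of_nhds]
  rcases Nat.eq_zero_or_pos i with rfl | hi
  · simp
  · rw [iteratedFDeriv_const_of_ne hi.ne']
    simp

/-- **The cut-off field is jointly `C^∞` below the height `T'`** when `V` is jointly `C^∞` on the
slab `(0, T') × E`: it vanishes near heights `< 1/4` and is a product of smooth functions at
heights in `(0, T')`. [folklore] -/
theorem contDiffOn_duhamelCutoff_smul (hV : ContDiffOn ℝ ∞ (uncurry V) (Ioo 0 T' ×ˢ univ)) :
    ContDiffOn ℝ ∞ (fun r : ℝ × E => duhamelCutoff r.1 • V r.1 r.2) (Iio T' ×ˢ univ) := by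
  intro r hr
  have hrT : r.1 < T' := (mem_prod.1 hr).1
  rcases lt_or_ge r.1 (1 / 4) with hlt | hge
  · exact ((contDiffAt_const (c := (0 : E))).congr_of_eventuallyEq
      (duhamelCutoff_smul_eventuallyEq_zero hlt V)).contDiffWithinAt
  · have hr0 : 0 < r.1 := lt_of_lt_of_le (by norm_num) hge
    have hopen : IsOpen (Ioo (0 : ℝ) T' ×ˢ (univ : Set E)) := isOpen_Ioo.prod isOpen_univ
    have hmem : r ∈ Ioo (0 : ℝ) T' ×ˢ (univ : Set E) := mk_mem_prod ⟨hr0, hrT⟩ (mem_univ _)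
    have hprod : ContDiffOn ℝ ∞ (fun r : ℝ × E => duhamelCutoff r.1 • V r.1 r.2)
        (Ioo 0 T' ×ˢ univ) :=
      contDiff_duhamelCutoff_fst.contDiffOn.smul hV
    exact (hprod.contDiffAt (hopen.mem_nhds hmem)).contDiffWithinAt

/-- **Leibniz bound for the cut-off field on the slab**: at heights in `(0, T')`,
`‖D^i (χV)(r)‖ ≤ Σ_{k ≤ i} (i choose k) ‖D^k χ(r)‖ ‖D^{i-k} V(r)‖`. [folklore] -/
theorem norm_iteratedFDeriv_duhamelCutoff_smul_le (hV : ContDiffOn ℝ ∞ (uncurry V) (Ioo 0 T' ×ˢ univ))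
    {r : ℝ × E} (hr : r ∈ Ioo (0 : ℝ) T' ×ˢ (univ : Set E)) (i : ℕ) :
    ‖iteratedFDeriv ℝ i (fun r : ℝ × E => duhamelCutoff r.1 • V r.1 r.2) r‖ ≤
      ∑ k ∈ Finset.range (i + 1), (i.choose k : ℝ) *
        ‖iteratedFDeriv ℝ k (fun r : ℝ × E => duhamelCutoff r.1) r‖ *
        ‖iteratedFDeriv ℝ (i - k) (uncurry V) r‖ := by
  have hopen : IsOpen (Ioo (0 : ℝ) T' ×ˢ (univ : Set E)) := isOpen_Ioo.prod isOpen_univ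
  have h := norm_iteratedFDerivWithin_smul_le (contDiff_duhamelCutoff_fst (E := E)).contDiffOn hV
    hopen.uniqueDiffOn hr (n := i) (by exact_mod_cast le_top)
  rw [iteratedFDerivWithin_of_isOpen i hopen hr] at h
  refine h.trans (le_of_eq ?_)
  refine Finset.sum_congr rfl fun k _ => ?_
  rw [iteratedFDerivWithin_of_isOpen k hopen hr, iteratedFDerivWithin_of_isOpen (i - k) hopen hr]

/-- **Bounded derivatives of the cut-off field (qualitative)**: if every derivative of `V` is
bounded at heights in `[1/4, T')`, then every derivative of `χV` is bounded below the height
`T'`. [folklore] -/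
theorem exists_norm_iteratedFDeriv_duhamelCutoff_smul_le
    (hV : ContDiffOn ℝ ∞ (uncurry V) (Ioo 0 T' ×ˢ univ))
    (hVb : ∀ i : ℕ, ∃ C : ℝ, ∀ r ∈ Ico (1 / 4 : ℝ) T' ×ˢ (univ : Set E),
      ‖iteratedFDeriv ℝ i (uncurry V) r‖ ≤ C) (i : ℕ) :
    ∃ C : ℝ, ∀ r : ℝ × E, r.1 < T' →
      ‖iteratedFDeriv ℝ i (fun r : ℝ × E => duhamelCutoff r.1 • V r.1 r.2) r‖ ≤ C := by
  obtain ⟨cχ, hcχ0, hcχ⟩ := exists_forall_le_norm_iteratedFDeriv_duhamelCutoff_fst_le (E := E) i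
  have hVb' : ∀ j : ℕ, ∃ C : ℝ, ∀ r : ℝ × E, r ∈ Ico (1 / 4 : ℝ) T' ×ˢ (univ : Set E) →
      ‖iteratedFDeriv ℝ j (uncurry V) r‖ ≤ C := fun j => hVb j
  obtain ⟨CV, hCV0, hCV⟩ := exists_forall_le_norm_iteratedFDeriv_le hVb' i
  refine ⟨2 ^ i * cχ * CV, fun r hrT => ?_⟩
  rcases lt_or_ge r.1 (1 / 4) with hlt | hge
  · rw [iteratedFDeriv_duhamelCutoff_smul_eq_zero hlt V i, norm_zero]
    positivity
  · have hr0 : 0 < r.1 := lt_of_lt_of_le (by norm_num) hge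
    have hr : r ∈ Ioo (0 : ℝ) T' ×ˢ (univ : Set E) := mk_mem_prod ⟨hr0, hrT⟩ (mem_univ _)
    have hr' : r ∈ Ico (1 / 4 : ℝ) T' ×ˢ (univ : Set E) := mk_mem_prod ⟨hge, hrT⟩ (mem_univ _)
    refine (norm_iteratedFDeriv_duhamelCutoff_smul_le hV hr i).trans ?_
    rw [← sum_range_choose_mul_const]
    refine Finset.sum_le_sum fun k hk => ?_
    have hki : k ≤ i := Nat.lt_succ_iff.1 (Finset.mem_range.1 hk)
    have h0 : (0 : ℝ) ≤ (i.choose k : ℝ) := by positivity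
    exact mul_le_mul (mul_le_mul_of_nonneg_left (hcχ k hki r) h0) (hCV (i - k) (Nat.sub_le i k) r hr')
      (norm_nonneg _) (mul_nonneg h0 hcχ0)

/-- **Bounded derivatives of the cut-off field (quantitative)**: for every `N` there is
`c = c(N, E) ≥ 0` such that, for `T' ≥ 1` and `V` jointly `C^∞` on `(0, T') × E` with derivatives
of orders `≤ N` bounded by `C_V ≥ 0` at heights in `[1/4, 1]`, the derivatives of orders `≤ N` of
`χV` are bounded by `c C_V` below the height `1`. [folklore] -/
theorem exists_norm_iteratedFDeriv_duhamelCutoff_smul_le_mul (N : ℕ) :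
    ∃ c : ℝ, 0 ≤ c ∧ ∀ {T' : ℝ} {V : ℝ → E → E} {CV : ℝ}, 1 ≤ T' →
      ContDiffOn ℝ ∞ (uncurry V) (Ioo 0 T' ×ˢ univ) → 0 ≤ CV →
      (∀ i ≤ N, ∀ r ∈ Icc (1 / 4 : ℝ) 1 ×ˢ (univ : Set E), ‖iteratedFDeriv ℝ i (uncurry V) r‖ ≤ CV) →
      ∀ i ≤ N, ∀ r : ℝ × E, r.1 < 1 →
        ‖iteratedFDeriv ℝ i (fun r : ℝ × E => duhamelCutoff r.1 • V r.1 r.2) r‖ ≤ c * CV := by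
  obtain ⟨cχ, hcχ0, hcχ⟩ := exists_forall_le_norm_iteratedFDeriv_duhamelCutoff_fst_le (E := E) N
  refine ⟨2 ^ N * cχ, by positivity, ?_⟩
  intro T' V CV hT' hV hCV hVb i hi r hr1
  rcases lt_or_ge r.1 (1 / 4) with hlt | hge
  · rw [iteratedFDeriv_duhamelCutoff_smul_eq_zero hlt V i, norm_zero]
    positivity
  · have hr0 : 0 < r.1 := lt_of_lt_of_le (by norm_num) hge
    have hr : r ∈ Ioo (0 : ℝ) T' ×ˢ (univ : Set E) :=
      mk_mem_prod ⟨hr0, lt_of_lt_of_le hr1 hT'⟩ (mem_univ _)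
    have hr' : r ∈ Icc (1 / 4 : ℝ) 1 ×ˢ (univ : Set E) := mk_mem_prod ⟨hge, hr1.le⟩ (mem_univ _)
    refine (norm_iteratedFDeriv_duhamelCutoff_smul_le hV hr i).trans ?_
    calc ∑ k ∈ Finset.range (i + 1), (i.choose k : ℝ) *
          ‖iteratedFDeriv ℝ k (fun r : ℝ × E => duhamelCutoff r.1) r‖ *
          ‖iteratedFDeriv ℝ (i - k) (uncurry V) r‖
        ≤ ∑ k ∈ Finset.range (i + 1), (i.choose k : ℝ) * cχ * CV := by
          refine Finset.sum_le_sum fun k hk => ?_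
          have hki : k ≤ i := Nat.lt_succ_iff.1 (Finset.mem_range.1 hk)
          have h0 : (0 : ℝ) ≤ (i.choose k : ℝ) := by positivity
          exact mul_le_mul (mul_le_mul_of_nonneg_left (hcχ k (hki.trans hi) r) h0)
            (hVb (i - k) ((Nat.sub_le i k).trans hi) r hr') (norm_nonneg _) (mul_nonneg h0 hcχ0)
      _ = 2 ^ i * cχ * CV := sum_range_choose_mul_const i cχ CV
      _ ≤ 2 ^ N * cχ * CV := by
          have h2 : (2 : ℝ) ^ i ≤ 2 ^ N := pow_le_pow_right₀ (by norm_num) hi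
          have := mul_le_mul_of_nonneg_right h2 (mul_nonneg hcχ0 hCV)
          nlinarith [this]

end CutoffField

/-! ### The cut-off fields on the slab: measurability and bounds -/

section Slab

variable {E : Type*} [NormedAddCommGroup E] [InnerProductSpace ℝ E] [FiniteDimensional ℝ E]
  [MeasurableSpace E] [BorelSpace E]

variable {T' M : ℝ} {V : ℝ → E → E}

omit [FiniteDimensional ℝ E] [MeasurableSpace E] [BorelSpace E] in
/-- `|χ| ≤ 1`, so `‖χ(τ) V(τ, y)‖ ≤ M` when `‖V(τ, y)‖ ≤ M`. [folklore] -/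
theorem norm_duhamelCutoff_smul_le (hVM : ∀ τ ∈ Ioo 0 T', ∀ y, ‖V τ y‖ ≤ M) :
    ∀ τ ∈ Ioo 0 T', ∀ y, ‖duhamelCutoff τ • V τ y‖ ≤ M := by
  intro τ hτ y
  rw [norm_smul, Real.norm_of_nonneg (duhamelCutoff_nonneg τ)]
  have hM : 0 ≤ M := (norm_nonneg _).trans (hVM τ hτ y)
  calc duhamelCutoff τ * ‖V τ y‖ ≤ 1 * M :=
        mul_le_mul (duhamelCutoff_le_one τ) (hVM τ hτ y) (norm_nonneg _) zero_le_one
    _ = M := one_mul M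

omit [FiniteDimensional ℝ E] [MeasurableSpace E] [BorelSpace E] in
/-- `|1 - χ²| ≤ 1`, so `‖(1 - χ(τ)²) V(τ, y)‖ ≤ M` when `‖V(τ, y)‖ ≤ M`. [folklore] -/
theorem norm_one_sub_duhamelCutoff_sq_smul_le (hVM : ∀ τ ∈ Ioo 0 T', ∀ y, ‖V τ y‖ ≤ M) :
    ∀ τ ∈ Ioo 0 T', ∀ y, ‖(1 - duhamelCutoff τ ^ 2) • V τ y‖ ≤ M := by
  intro τ hτ y
  rw [norm_smul, Real.norm_eq_abs]
  have hM : 0 ≤ M := (norm_nonneg _).trans (hVM τ hτ y)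
  calc |1 - duhamelCutoff τ ^ 2| * ‖V τ y‖ ≤ 1 * M :=
        mul_le_mul (abs_one_sub_duhamelCutoff_sq_le_one τ) (hVM τ hτ y) (norm_nonneg _) zero_le_one
    _ = M := one_mul M

/-- A field jointly continuous on the slab is a.e. strongly measurable there. [folklore] -/
theorem aestronglyMeasurable_uncurry_of_continuousOn (hV : ContinuousOn (uncurry V) (Ioo 0 T' ×ˢ univ)) :
    AEStronglyMeasurable (uncurry V) ((volume : Measure (ℝ × E)).restrict (Ioo 0 T' ×ˢ univ)) :=
  hV.aestronglyMeasurable (measurableSet_Ioo.prod MeasurableSet.univ)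

/-- The cut-off field `χV` is a.e. strongly measurable on the slab. [folklore] -/
theorem aestronglyMeasurable_duhamelCutoff_smul (hV : ContinuousOn (uncurry V) (Ioo 0 T' ×ˢ univ)) :
    AEStronglyMeasurable (uncurry fun τ y => duhamelCutoff τ • V τ y)
      ((volume : Measure (ℝ × E)).restrict (Ioo 0 T' ×ˢ univ)) := by
  have hc : ContinuousOn (fun r : ℝ × E => duhamelCutoff r.1 • uncurry V r) (Ioo 0 T' ×ˢ univ) :=
    (continuous_duhamelCutoff.comp continuous_fst).continuousOn.smul hV
  exact hc.aestronglyMeasurable (measurableSet_Ioo.prod MeasurableSet.univ)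

/-- The field `(1 - χ²)V` is a.e. strongly measurable on the slab. [folklore] -/
theorem aestronglyMeasurable_one_sub_duhamelCutoff_sq_smul
    (hV : ContinuousOn (uncurry V) (Ioo 0 T' ×ˢ univ)) :
    AEStronglyMeasurable (uncurry fun τ y => (1 - duhamelCutoff τ ^ 2) • V τ y)
      ((volume : Measure (ℝ × E)).restrict (Ioo 0 T' ×ˢ univ)) := by
  have hc : ContinuousOn (fun r : ℝ × E => (1 - duhamelCutoff r.1 ^ 2) • uncurry V r)
      (Ioo 0 T' ×ˢ univ) :=
    (continuous_const.sub ((continuous_duhamelCutoff.comp continuous_fst).pow 2)).continuousOn.smul hV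
  exact hc.aestronglyMeasurable (measurableSet_Ioo.prod MeasurableSet.univ)

end Slab

/-! ### The reflection `q ↦ p - q` of the space-time slab -/

section Reflection

variable {E : Type*} [NormedAddCommGroup E] [InnerProductSpace ℝ E] [FiniteDimensional ℝ E]
  [MeasurableSpace E] [BorelSpace E]

/-- The reflection `q ↦ p - q` of `ℝ × E` preserves Lebesgue measure. [folklore] -/
theorem measurePreserving_const_sub_prod (p : ℝ × E) :
    MeasurePreserving (fun q : ℝ × E => p - q) (volume : Measure (ℝ × E)) volume := by
  have h := (Measure.measurePreserving_sub_left (volume : Measure ℝ) p.1).prod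
    (Measure.measurePreserving_sub_left (volume : Measure E) p.2)
  exact h

omit [InnerProductSpace ℝ E] [FiniteDimensional ℝ E] [MeasurableSpace E] [BorelSpace E] in
/-- The reflection maps the slab `(0, θ) × E` below the height `θ = p.1` onto itself. [folklore] -/
theorem const_sub_preimage_slab (p : ℝ × E) :
    (fun q : ℝ × E => p - q) ⁻¹' (Ioo 0 p.1 ×ˢ (univ : Set E)) = Ioo 0 p.1 ×ˢ univ := by
  ext q
  simp only [mem_preimage, mem_prod, mem_univ, and_true, mem_Ioo, Prod.fst_sub]
  constructor
  · rintro ⟨h1, h2⟩; constructor <;> linarith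
  · rintro ⟨h1, h2⟩; constructor <;> linarith

end Reflection

/-! ### The far/near splitting at unit scale -/

section UnitScale

variable {E : Type*} [NormedAddCommGroup E] [InnerProductSpace ℝ E] [FiniteDimensional ℝ E]
  [MeasurableSpace E] [BorelSpace E]

variable {T' MV MW : ℝ} {V W : ℝ → E → E}

omit [FiniteDimensional ℝ E] [MeasurableSpace E] [BorelSpace E] in
/-- **The bilinear splitting of the integrand**: `K[a, b] = K[(1 - χ²)a, b] + K[χa, χb]`.
[folklore] -/
theorem oseenKernel_eq_cutoff_split (σ : ℝ) (z a b : E) (c : ℝ) :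
    oseenKernel σ z a b = oseenKernel σ z ((1 - c ^ 2) • a) b + oseenKernel σ z (c • a) (c • b) := by
  rw [oseenKernel_smul_left, oseenKernel_smul_left, oseenKernel_smul_right, smul_smul, ← add_smul]
  have : (1 - c ^ 2) + c * c = 1 := by ring
  rw [this, one_smul]

/-- **Far/near splitting of the Duhamel term at unit scale.** For `V`, `W` jointly `C^∞` and
bounded on the slab `(0, T') × E`, `b ≤ T'` and `p = (θ, ξ)` with `1/2 < θ < b`:
`B^1_0(V, W)(θ, ξ) = ∫_{(0,1/2)×E} K(θ-τ, ξ-y)[(1-χ(τ)²)V(τ,y), W(τ,y)] d(τ,y)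
  + ∫_{(0,b)×E} K(q)[(χV)(p - q), (χW)(p - q)] dq`
(bilinearity, the reflection `q ↦ p - q` of `(0, θ) × E`, and the vanishing of `1 - χ²` above
the height `1/2` and of `χ` below `1/4`). KNSS 2009, §4: the form of `B` ((4.3)) behind the
weighted estimate. [cite: KochNadirashviliSereginSverak2009, §4 (4.3)–(4.4) and Prop. 4.1 (arXiv:0709.3599 p. 8)] -/
theorem oseenDuhamel_one_eq_far_add_near
    (hV : ContDiffOn ℝ ∞ (uncurry V) (Ioo 0 T' ×ˢ univ)) (hW : ContDiffOn ℝ ∞ (uncurry W) (Ioo 0 T' ×ˢ univ))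
    (hMV : 0 ≤ MV) (hVM : ∀ τ ∈ Ioo 0 T', ∀ y, ‖V τ y‖ ≤ MV) (hWM : ∀ τ ∈ Ioo 0 T', ∀ y, ‖W τ y‖ ≤ MW)
    {b : ℝ} (hbT : b ≤ T') {p : ℝ × E} (hp : p ∈ Ioo (1 / 2 : ℝ) b ×ˢ (univ : Set E)) :
    oseenDuhamel 1 0 V W p.1 p.2 =
      (∫ q in Ioo (0 : ℝ) (1 / 2) ×ˢ univ, oseenKernel (p.1 - q.1) (p.2 - q.2)
          ((1 - duhamelCutoff q.1 ^ 2) • V q.1 q.2) (W q.1 q.2) ∂(volume : Measure (ℝ × E))) +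
      ∫ q in Ioo (0 : ℝ) b ×ˢ univ, oseenKernel q.1 q.2
          (duhamelCutoff (p - q).1 • V (p - q).1 (p - q).2)
          (duhamelCutoff (p - q).1 • W (p - q).1 (p - q).2) ∂(volume : Measure (ℝ × E)) := by
  obtain ⟨hp1, -⟩ := mem_prod.1 hp
  have hθ0 : 0 < p.1 := lt_trans (by norm_num) hp1.1
  have hθT : p.1 ≤ T' := hp1.2.le.trans hbT
  set M : ℝ := max MV MW with hM_def
  have hM0 : 0 ≤ M := le_max_of_le_left hMV
  have hVm := aestronglyMeasurable_uncurry_of_continuousOn hV.continuousOn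
  have hWm := aestronglyMeasurable_uncurry_of_continuousOn hW.continuousOn
  have hVM' : ∀ τ ∈ Ioo 0 T', ∀ y, ‖V τ y‖ ≤ M := fun τ hτ y => (hVM τ hτ y).trans (le_max_left _ _)
  have hWM' : ∀ τ ∈ Ioo 0 T', ∀ y, ‖W τ y‖ ≤ M := fun τ hτ y => (hWM τ hτ y).trans (le_max_right _ _)
  -- the cut-off fields
  have hV'm := aestronglyMeasurable_one_sub_duhamelCutoff_sq_smul (E := E) (T' := T') hV.continuousOn
  have hV'M := norm_one_sub_duhamelCutoff_sq_smul_le hVM'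
  have hVcm := aestronglyMeasurable_duhamelCutoff_smul (E := E) (T' := T') hV.continuousOn
  have hWcm := aestronglyMeasurable_duhamelCutoff_smul (E := E) (T' := T') hW.continuousOn
  have hVcM := norm_duhamelCutoff_smul_le hVM'
  have hWcM := norm_duhamelCutoff_smul_le hWM'
  -- Step 1: product form
  rw [oseenDuhamel_eq_integral_prod one_pos hVm hWm hM0 hVM' hWM' hθ0 hθT p.2]
  have hSθ : MeasurableSet (Ioo (0 : ℝ) p.1 ×ˢ (univ : Set E)) := measurableSet_Ioo.prod MeasurableSet.univ
  -- Step 2: bilinear splitting of the integrand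
  rw [setIntegral_congr_fun hSθ (fun q _ =>
    oseenKernel_eq_cutoff_split (1 * (p.1 - q.1)) (p.2 - q.2) (V q.1 q.2) (W q.1 q.2) (duhamelCutoff q.1))]
  have hint1 : Integrable (fun q : ℝ × E => oseenKernel (1 * (p.1 - q.1)) (p.2 - q.2)
      ((1 - duhamelCutoff q.1 ^ 2) • V q.1 q.2) (W q.1 q.2))
      ((volume : Measure (ℝ × E)).restrict (Ioo 0 p.1 ×ˢ univ)) :=
    integrable_oseenKernel_duhamel_bounded (u := fun τ y => (1 - duhamelCutoff τ ^ 2) • V τ y) (v := W)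
      one_pos hV'm hWm hM0 hV'M hWM' hθ0 hθT p.2
  have hint2 : Integrable (fun q : ℝ × E => oseenKernel (1 * (p.1 - q.1)) (p.2 - q.2)
      (duhamelCutoff q.1 • V q.1 q.2) (duhamelCutoff q.1 • W q.1 q.2))
      ((volume : Measure (ℝ × E)).restrict (Ioo 0 p.1 ×ˢ univ)) :=
    integrable_oseenKernel_duhamel_bounded (u := fun τ y => duhamelCutoff τ • V τ y)
      (v := fun τ y => duhamelCutoff τ • W τ y) one_pos hVcm hWcm hM0 hVcM hWcM hθ0 hθT p.2
  rw [integral_add hint1 hint2]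
  congr 1
  · -- Step 3: the far part lives on `(0, 1/2) × E`
    have hsub : Ioo (0 : ℝ) (1 / 2) ×ˢ (univ : Set E) ⊆ Ioo 0 p.1 ×ˢ univ :=
      prod_mono (Ioo_subset_Ioo_right hp1.1.le) subset_rfl
    rw [setIntegral_eq_of_subset_of_forall_sdiff_eq_zero hSθ hsub]
    · refine setIntegral_congr_fun (measurableSet_Ioo.prod MeasurableSet.univ) fun q _ => ?_
      rw [one_mul]
    · intro q hq
      obtain ⟨hq1, hq2⟩ := hq
      have hq1' : q.1 ∈ Ioo 0 p.1 := (mem_prod.1 hq1).1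
      have hge : 1 / 2 ≤ q.1 := by
        by_contra h
        exact hq2 (mk_mem_prod ⟨hq1'.1, lt_of_not_ge h⟩ (mem_univ _))
      rw [duhamelCutoff_of_ge hge, one_pow, sub_self, zero_smul, oseenKernel_zero_left]
  · -- Step 4: the near part, reflected and extended to `(0, b) × E`
    have hrefl := (measurePreserving_const_sub_prod p).setIntegral_preimage_emb
      (measurableEmbedding_subLeft p)
      (fun q : ℝ × E => oseenKernel q.1 q.2 (duhamelCutoff (p - q).1 • V (p - q).1 (p - q).2)
        (duhamelCutoff (p - q).1 • W (p - q).1 (p - q).2)) (Ioo 0 p.1 ×ˢ univ)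
    rw [const_sub_preimage_slab] at hrefl
    have hSb : MeasurableSet (Ioo (0 : ℝ) b ×ˢ (univ : Set E)) := measurableSet_Ioo.prod MeasurableSet.univ
    have hsub : Ioo (0 : ℝ) p.1 ×ˢ (univ : Set E) ⊆ Ioo 0 b ×ˢ univ :=
      prod_mono (Ioo_subset_Ioo_right hp1.2.le) subset_rfl
    rw [setIntegral_eq_of_subset_of_forall_sdiff_eq_zero hSb hsub, ← hrefl]
    · refine setIntegral_congr_fun hSθ fun q _ => ?_
      simp only [Prod.fst_sub, Prod.snd_sub, sub_sub_cancel, one_mul]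
    · intro q hq
      obtain ⟨hq1, hq2⟩ := hq
      have hq1' : q.1 ∈ Ioo 0 b := (mem_prod.1 hq1).1
      have hge : p.1 ≤ q.1 := by
        by_contra h
        exact hq2 (mk_mem_prod ⟨hq1'.1, lt_of_not_ge h⟩ (mem_univ _))
      have hle : (p - q).1 ≤ 1 / 4 := by
        rw [Prod.fst_sub]
        linarith
      rw [duhamelCutoff_of_le hle, zero_smul, oseenKernel_zero_left]

/-- **The Duhamel term at unit scale is jointly `C^∞` near unit height**: for `V`, `W` jointly
`C^∞` and bounded on `(0, T') × E`, `T' > 1`, with every derivative bounded at heights in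
`[1/4, T')`, `B^1_0(V, W)` is `C^∞` on `(1/2, min T' 2) × E` (far part: derivatives on the
kernel; near part: derivatives on the cut-off fields). KNSS 2009, Prop. 4.1 (qualitative part:
all the weighted derivatives exist). [cite: KochNadirashviliSereginSverak2009, §4 Prop. 4.1 (arXiv:0709.3599 p. 8)] -/
theorem contDiffOn_oseenDuhamel_one (hT' : 1 < T')
    (hV : ContDiffOn ℝ ∞ (uncurry V) (Ioo 0 T' ×ˢ univ)) (hW : ContDiffOn ℝ ∞ (uncurry W) (Ioo 0 T' ×ˢ univ))
    (hVb : ∀ i : ℕ, ∃ C : ℝ, ∀ r ∈ Ico (1 / 4 : ℝ) T' ×ˢ (univ : Set E), ‖iteratedFDeriv ℝ i (uncurry V) r‖ ≤ C)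
    (hWb : ∀ i : ℕ, ∃ C : ℝ, ∀ r ∈ Ico (1 / 4 : ℝ) T' ×ˢ (univ : Set E), ‖iteratedFDeriv ℝ i (uncurry W) r‖ ≤ C)
    (hMV : 0 ≤ MV) (hMW : 0 ≤ MW)
    (hVM : ∀ τ ∈ Ioo 0 T', ∀ y, ‖V τ y‖ ≤ MV) (hWM : ∀ τ ∈ Ioo 0 T', ∀ y, ‖W τ y‖ ≤ MW) :
    ContDiffOn ℝ ∞ (uncurry (oseenDuhamel 1 0 V W)) (Ioo (1 / 2 : ℝ) (min T' 2) ×ˢ univ) := by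
  set b : ℝ := min T' 2 with hb_def
  have hb1 : 1 < b := lt_min hT' (by norm_num)
  have hb0 : 0 < b := lt_trans one_pos hb1
  have hbT : b ≤ T' := min_le_left _ _
  -- the far part
  have hV'm := aestronglyMeasurable_one_sub_duhamelCutoff_sq_smul (E := E) (T' := T') hV.continuousOn
  have hWm := aestronglyMeasurable_uncurry_of_continuousOn hW.continuousOn
  have hV'M := norm_one_sub_duhamelCutoff_sq_smul_le hVM
  have hfar := contDiffOn_oseenDuhamelFar (E := E) (t₁ := 1 / 2) (T := T')
    (v := fun τ y => (1 - duhamelCutoff τ ^ 2) • V τ y) (w := W) (by norm_num) (by linarith)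
    hV'm hWm hMV hMW hV'M hWM
  -- the near part
  have hF := contDiffOn_duhamelCutoff_smul hV
  have hG := contDiffOn_duhamelCutoff_smul hW
  have hFb := exists_norm_iteratedFDeriv_duhamelCutoff_smul_le hV hVb
  have hGb := exists_norm_iteratedFDeriv_duhamelCutoff_smul_le hW hWb
  have hnear := contDiffOn_oseenKernel_conv hb0 hbT hF hG hFb hGb
  -- assemble
  have hsum := (hfar.mono (show Ioo (1 / 2 : ℝ) b ×ˢ (univ : Set E) ⊆ Ioi (1 / 2) ×ˢ univ from
      prod_mono Ioo_subset_Ioi_self subset_rfl)).add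
    (hnear.mono (show Ioo (1 / 2 : ℝ) b ×ˢ (univ : Set E) ⊆ Iio b ×ˢ univ from
      prod_mono Ioo_subset_Iio_self subset_rfl))
  refine hsum.congr fun p hp => ?_
  exact oseenDuhamel_one_eq_far_add_near hV hW hMV hVM hWM hbT hp

/-- **The weighted bilinear estimate at unit scale**: for every order `N` there is
`A = A(N, E) ≥ 0` such that for `T' > 1`, fields `V`, `W` jointly `C^∞` on `(0, T') × E` with
every derivative bounded at heights in `[1/4, T')`, bounded by `M_V ≤ C_V`, `M_W ≤ C_W` on the
slab and with derivatives of orders `≤ N` bounded by `C_V`, `C_W` at heights in `[1/4, 1]`: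
`‖D^m B^1_0(V, W)(1, ξ)‖ ≤ A C_V C_W` for all `m ≤ N` and all `ξ`. This is the isotropic unit-scale
form of the estimate of `B` "with the same form as (4.4) but in spaces with norms given by the
left-hand side of (4.5)" (KNSS 2009, §4 p. 8). [cite: KochNadirashviliSereginSverak2009, §4 (4.4)–(4.5) and Prop. 4.1 (arXiv:0709.3599 p. 8)] -/
theorem exists_norm_iteratedFDeriv_oseenDuhamel_one_le (N : ℕ) :
    ∃ A : ℝ, 0 ≤ A ∧ ∀ {T' MV MW CV CW : ℝ} {V W : ℝ → E → E}, 1 < T' →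
      ContDiffOn ℝ ∞ (uncurry V) (Ioo 0 T' ×ˢ univ) → ContDiffOn ℝ ∞ (uncurry W) (Ioo 0 T' ×ˢ univ) →
      (∀ i : ℕ, ∃ C : ℝ, ∀ r ∈ Ico (1 / 4 : ℝ) T' ×ˢ (univ : Set E), ‖iteratedFDeriv ℝ i (uncurry V) r‖ ≤ C) →
      (∀ i : ℕ, ∃ C : ℝ, ∀ r ∈ Ico (1 / 4 : ℝ) T' ×ˢ (univ : Set E), ‖iteratedFDeriv ℝ i (uncurry W) r‖ ≤ C) →
      0 ≤ MV → 0 ≤ MW →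
      (∀ τ ∈ Ioo 0 T', ∀ y, ‖V τ y‖ ≤ MV) → (∀ τ ∈ Ioo 0 T', ∀ y, ‖W τ y‖ ≤ MW) →
      MV ≤ CV → MW ≤ CW →
      (∀ i ≤ N, ∀ r ∈ Icc (1 / 4 : ℝ) 1 ×ˢ (univ : Set E), ‖iteratedFDeriv ℝ i (uncurry V) r‖ ≤ CV) →
      (∀ i ≤ N, ∀ r ∈ Icc (1 / 4 : ℝ) 1 ×ˢ (univ : Set E), ‖iteratedFDeriv ℝ i (uncurry W) r‖ ≤ CW) →
      ∀ m ≤ N, ∀ ξ : E,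
        ‖iteratedFDeriv ℝ m (uncurry (oseenDuhamel 1 0 V W)) (1, ξ)‖ ≤ A * CV * CW := by
  -- the constants
  choose Cfar hCfar0 hCfar using fun m => exists_norm_iteratedFDeriv_oseenDuhamelFar_le (E := E) m
  obtain ⟨Cnear, hCnear, hnear⟩ := exists_norm_iteratedFDeriv_oseenKernel_conv_le (E := E)
  obtain ⟨c, hc0, hcut⟩ := exists_norm_iteratedFDeriv_duhamelCutoff_smul_le_mul (E := E) N
  set Afar : ℝ := ∑ m ∈ Finset.range (N + 1),
    Cfar m * (1 / 2) * (1 - 1 / 2 : ℝ) ^ (-(1 / 2 : ℝ) - m) with hAfar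
  set Anear : ℝ := 2 ^ N * c * c * (Cnear * (2 * Real.sqrt 2)) with hAnear
  have hAfar0 : 0 ≤ Afar := Finset.sum_nonneg fun m _ => by
    have : 0 ≤ (1 - 1 / 2 : ℝ) ^ (-(1 / 2 : ℝ) - m) := Real.rpow_nonneg (by norm_num) _
    have := hCfar0 m
    positivity
  have hAnear0 : 0 ≤ Anear := by positivity
  refine ⟨Afar + Anear, add_nonneg hAfar0 hAnear0, ?_⟩
  intro T' MV MW CV CW V W hT' hV hW hVb hWb hMV hMW hVM hWM hMCV hMCW hVN hWN m hm ξ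
  have hCV : 0 ≤ CV := hMV.trans hMCV
  have hCW : 0 ≤ CW := hMW.trans hMCW
  set b : ℝ := min T' 2 with hb_def
  have hb1 : 1 < b := lt_min hT' (by norm_num)
  have hb0 : 0 < b := lt_trans one_pos hb1
  have hbT : b ≤ T' := min_le_left _ _
  have hb2 : b ≤ 2 := min_le_right _ _
  -- the two parts and their smoothness
  have hV'm := aestronglyMeasurable_one_sub_duhamelCutoff_sq_smul (E := E) (T' := T') hV.continuousOn
  have hWm := aestronglyMeasurable_uncurry_of_continuousOn hW.continuousOn
  have hV'M := norm_one_sub_duhamelCutoff_sq_smul_le hVM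
  have hfar := contDiffOn_oseenDuhamelFar (E := E) (t₁ := 1 / 2) (T := T')
    (v := fun τ y => (1 - duhamelCutoff τ ^ 2) • V τ y) (w := W) (by norm_num) (by linarith)
    hV'm hWm hMV hMW hV'M hWM
  have hF := contDiffOn_duhamelCutoff_smul hV
  have hG := contDiffOn_duhamelCutoff_smul hW
  have hFb := exists_norm_iteratedFDeriv_duhamelCutoff_smul_le hV hVb
  have hGb := exists_norm_iteratedFDeriv_duhamelCutoff_smul_le hW hWb
  have hnearS := contDiffOn_oseenKernel_conv hb0 hbT hF hG hFb hGb
  -- the point `(1, ξ)`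
  have hp : ((1 : ℝ), ξ) ∈ Ioo (1 / 2 : ℝ) b ×ˢ (univ : Set E) :=
    mk_mem_prod ⟨by norm_num, hb1⟩ (mem_univ _)
  have hpfar : ((1 : ℝ), ξ) ∈ Ioi (1 / 2 : ℝ) ×ˢ (univ : Set E) := mk_mem_prod (by norm_num) (mem_univ _)
  have hpnear : ((1 : ℝ), ξ) ∈ Iio b ×ˢ (univ : Set E) := mk_mem_prod hb1 (mem_univ _)
  have hopen : IsOpen (Ioo (1 / 2 : ℝ) b ×ˢ (univ : Set E)) := isOpen_Ioo.prod isOpen_univ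
  -- `B = far + near` near `(1, ξ)`
  have hev : uncurry (oseenDuhamel 1 0 V W) =ᶠ[𝓝 ((1 : ℝ), ξ)]
      (fun p : ℝ × E => ∫ q in Ioo (0 : ℝ) (1 / 2) ×ˢ univ, oseenKernel (p.1 - q.1) (p.2 - q.2)
          ((1 - duhamelCutoff q.1 ^ 2) • V q.1 q.2) (W q.1 q.2) ∂(volume : Measure (ℝ × E))) +
      fun p : ℝ × E => ∫ q in Ioo (0 : ℝ) b ×ˢ univ, oseenKernel q.1 q.2
          (duhamelCutoff (p - q).1 • V (p - q).1 (p - q).2)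
          (duhamelCutoff (p - q).1 • W (p - q).1 (p - q).2) ∂(volume : Measure (ℝ × E)) := by
    filter_upwards [hopen.mem_nhds hp] with p hp'
    exact oseenDuhamel_one_eq_far_add_near hV hW hMV hVM hWM hbT hp'
  have hfarAt := (hfar.contDiffAt ((isOpen_Ioi.prod isOpen_univ).mem_nhds hpfar)).of_le
    (show ((m : ℕ∞) : WithTop ℕ∞) ≤ ((⊤ : ℕ∞) : WithTop ℕ∞) by exact_mod_cast le_top)
  have hnearAt := (hnearS.contDiffAt ((isOpen_Iio.prod isOpen_univ).mem_nhds hpnear)).of_le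
    (show ((m : ℕ∞) : WithTop ℕ∞) ≤ ((⊤ : ℕ∞) : WithTop ℕ∞) by exact_mod_cast le_top)
  rw [(hev.iteratedFDeriv ℝ m).eq_of_nhds, iteratedFDeriv_add_apply hfarAt hnearAt]
  refine (norm_add_le _ _).trans ?_
  -- the far bound
  have hfarle : ‖iteratedFDeriv ℝ m (fun p : ℝ × E => ∫ q in Ioo (0 : ℝ) (1 / 2) ×ˢ univ,
      oseenKernel (p.1 - q.1) (p.2 - q.2) ((1 - duhamelCutoff q.1 ^ 2) • V q.1 q.2) (W q.1 q.2)
        ∂(volume : Measure (ℝ × E))) (1, ξ)‖ ≤ Afar * CV * CW := by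
    have h := hCfar m (T := T') (t₁ := 1 / 2) (v := fun τ y => (1 - duhamelCutoff τ ^ 2) • V τ y)
      (w := W) (by norm_num) (by linarith) hV'm hWm hMV hMW hV'M hWM (t := 1) (by norm_num) le_rfl ξ
    refine h.trans ?_
    have hrp : 0 ≤ (1 - 1 / 2 : ℝ) ^ (-(1 / 2 : ℝ) - m) := Real.rpow_nonneg (by norm_num) _
    have hterm : Cfar m * (1 / 2) * (1 - 1 / 2 : ℝ) ^ (-(1 / 2 : ℝ) - m) ≤ Afar := by
      rw [hAfar]
      refine Finset.single_le_sum (f := fun m => Cfar m * (1 / 2) * (1 - 1 / 2 : ℝ) ^ (-(1 / 2 : ℝ) - m))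
        (fun i _ => ?_) (Finset.mem_range.2 (Nat.lt_succ_of_le hm))
      have : 0 ≤ (1 - 1 / 2 : ℝ) ^ (-(1 / 2 : ℝ) - i) := Real.rpow_nonneg (by norm_num) _
      have := hCfar0 i
      positivity
    calc Cfar m * MV * MW * (1 / 2) * (1 - 1 / 2 : ℝ) ^ (-(1 / 2 : ℝ) - m)
        = (Cfar m * (1 / 2) * (1 - 1 / 2 : ℝ) ^ (-(1 / 2 : ℝ) - m)) * (MV * MW) := by ring
      _ ≤ Afar * (CV * CW) :=
          mul_le_mul hterm (mul_le_mul hMCV hMCW hMW hCV) (mul_nonneg hMV hMW) hAfar0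
      _ = Afar * CV * CW := by ring
  -- the near bound
  have hnearle : ‖iteratedFDeriv ℝ m (fun p : ℝ × E => ∫ q in Ioo (0 : ℝ) b ×ˢ univ, oseenKernel q.1 q.2
      (duhamelCutoff (p - q).1 • V (p - q).1 (p - q).2)
      (duhamelCutoff (p - q).1 • W (p - q).1 (p - q).2) ∂(volume : Measure (ℝ × E))) (1, ξ)‖ ≤
      Anear * CV * CW := by
    have hFq := hcut hT'.le hV hCV hVN
    have hGq := hcut hT'.le hW hCW hWN
    have h := hnear hb0 hbT hF hG hFb hGb m hpnear (CF := c * CV) (CG := c * CW)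
      (by positivity) (by positivity)
      (fun i hi r hr => hFq i (hi.trans hm) r hr) (fun i hi r hr => hGq i (hi.trans hm) r hr)
    refine h.trans ?_
    have hsq : Real.sqrt b ≤ Real.sqrt 2 := Real.sqrt_le_sqrt hb2
    have h2m : (2 : ℝ) ^ m ≤ 2 ^ N := pow_le_pow_right₀ (by norm_num) hm
    calc 2 ^ m * (c * CV) * (c * CW) * (Cnear * (2 * Real.sqrt b))
        ≤ 2 ^ N * (c * CV) * (c * CW) * (Cnear * (2 * Real.sqrt 2)) := by
          gcongr
      _ = Anear * CV * CW := by rw [hAnear]; ring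
  linarith [hfarle, hnearle]

end UnitScale

end Literature.Analysis.FluidPDE

end
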